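import Literature.MathematicalPhysics.QuantumFieldTheory.Balaban1983to89.Beta.BalabanStepJetsSucc

/-!
# `BalabanUV.Beta.GAN24.RespStepEffectiveEL` — binder row G-an2-4 / (CONV-C), CT-ROUTE (row owner, `gen20/BORNSEC-PLAN-v1.md` §0 (c1), located items
# X-gan24p1-g20-1 ∕ X-gan24p1-g20-2): **THE EULER–LAGRANGE IDENTITY OF THE COMPOSITE RESPONSE LEG AT EVERY BASE `M`, FOR THE LEVEL-`M` EFFECTIVE
# HESSIAN KERNEL — «the multiplier kernel `wΦ_M` paired with the response leg `respStep M (M·L)` is the `L`-CONTOUR-SUM TENT of the level-`M·L`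
# multiplier column»**

NOT IN PRINT; OUR BOOKKEEPING ([folklore] lattice linear algebra over an5∕an2's DEFINITIONS and THEOREMS BY NAME: `ResolventComposition.Hcol` ∕ `HΦcol` ∕
`curvAdj_curv_Hcol` (the minimiser column's Euler–Lagrange identity `d*d ℋ = 𝒬ᵀwΦ`, no gauge term — an5's `wM_eq_zero`), `contourSum_Hcol` (the (Q)
normalisation `𝒬_M ℋ_M = δ`), `contourSum_mul` (`𝒬_{ML} = 𝒬_L ∘ 𝒬_M`), `Hcol_bdd_summable`, `HΦcol_bdd`; an5's pairing calculus `KKTFluctuationEnergy.lip1` ∕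
`lip1_curvAdj` ∕ `lip2_comm` ∕ `lip1_contourSumAdj`; an2's `BalabanCompositeJets.respStep`).  0 `def`, 0 cited facts, 0 `def … : Prop`, 0 sorry; NO estimate.
HONEST FRAMING (cell contract, verbatim): «discharging `BetaPertH` makes Bałaban's UV stability UNCONDITIONAL — a real constructive-QFT result; it is NOT the
continuum limit and NOT the Clay problem.»  HONEST DEPENDENCY (verbatim): «continuum YM on T⁴ ⇐ BetaPertH ∧ nine spine estimates (0/9 proved); BetaPertH ⇐
(D1) ∧ (D4) ∧ CAP+tail; G-an2-4 gates asym, D1 and NE2/3/4.»  Discharges NO slot letter of (CONV-C); NEVER «G-an2-4 closed»; NOT D1, NOT `BetaPertH`, NOT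
continuum, NOT Clay.

## Why (owner's `CT3-MECHANISM-v1.2.md` §D (D2b) and `BORNSEC-PLAN-v1.md` §0 (c1))
The contact analysis of the border∕Λ-BORN sectors of the comb family (E) at base `m ≥ 1` needs a PARTNER LETTER for the composite response leg
`B_m = respStep (Lc^m) (Lc^{m+k+1})` through a second-order operator.  For the bare Maxwell operator `d*d` of the `Lc^m`-lattice there is no Euler–Lagrange
identity (the composite column from level `m+k+1` to level `m` minimises the level-`m` EFFECTIVE form, not `d*d`; v1.2 §D (D2b)).  But the operator that the
born sectors actually carry is the level-`m` EFFECTIVE HESSIAN KERNEL — the multiplier kernel `wΦ_{Lc^m}` (the Lagrange coefficient `lamCoeffK` and the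
undressed multiplier column `colM` both contain it; M-Λ ∕ M-V «Hessian transfer») — and for THAT operator the Euler–Lagrange identity holds EXACTLY at every
base: this file.  The right-hand side is a TENT — the `L`-contour-sum adjoint of the level-`M·L` multiplier column — which is where the contact cells of the
born sectors recover the Maxwell-letter smallness that the Wilson cells had at `m = 0` (`ContactPartnerLetters`).

## What is proved (generic `d`; every `M`, `L` with `[NeZero M] [NeZero L]`, `N′ = M·L`)
* `lip1_indicator_left` — pairing against the indicator 1-form of one bond evaluates.
* **`HΦcol_pair_respStep`**: `∑'_{w′} ∑_{l″} HΦcol (N := M) l w l″ w′ · respStep M N′ μ z l″ w′ = contourSumAdj L (HΦcol (N := N′) μ z) l w` — i.e.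
  `(wΦ_M ∗ B)(l, w) = (𝒬_Lᵀ wΦ_{N′}(·; μ, z))(l, w)` for the response leg `B = respStep M N′ μ z = 𝒬_M ℋ_{N′}(·; μ, z)`.  PROOF BY PAIRING (an5's pattern for
  `wH_reproduction`): pair the fine minimiser columns `T = ℋ_{N′}(·; μ, z)` and `S = ℋ_M(·; l, w)` through `d*d`; with `S`'s Euler–Lagrange identity the pairing
  is `Σ wΦ_M · 𝒬_M T` (the left side); with `T`'s it is `Σ wΦ_{N′} · 𝒬_{N′} S = Σ wΦ_{N′} · 𝒬_L (𝒬_M S) = Σ wΦ_{N′} · 𝒬_L δ_{(l,w)}` (the right side).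
* `wΦ_pair_respStep` — the same with the kernels' relative coordinates displayed.
* **`lamCoeffK_KInvStep_E2_eq_neg_contourSumAdj`** (X-gan24p1-g20-1, «M-Λ»): THE STEP LAGRANGE COEFFICIENT OF THE COMB FAMILY IS A TENT OF THE NEXT-LEVEL
  MULTIPLIER COLUMN — `lamCoeffK (KInvStep Lc j) (E2 d Lc j) Lc μ y κ u = −((Lc^j)^{d+2})⁻¹ · contourSumAdj Lc (fun κ′ y′ ↦ wΦ_{Lc^{j+1}} κ′ μ (y′ − y)) κ u` —
  the member-`j ≥ 1` twin of road S3's `TaylorLamBracket.lamCoeffOf_KInv_eq_neg_contourSumAdj` (member `0`): the Λ-source of EVERY member of (E) has the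
  one-shot row's algebraic shape (`KInvStep_inr_inl`: the step resolvent's `(inr, inl)` entries are `−(Lc^j)^{−(d+2)}·respStep`; `E2 = mmRead (KInv)`:
  `KInv_inr_inr_coarse`; then `wΦ_pair_respStep` at `M = Lc^j`, `L = Lc`).
Unit `b2b-balaban-gan24-p1` (row owner G-an2-4, gen 20), 2026-08-21.
-/

noncomputable section

open Finset
open scoped BigOperators
open Literature.MathematicalPhysics.QuantumFieldTheory.Balaban1983to89
open Literature.MathematicalPhysics.QuantumFieldTheory.Balaban1983to89.Beta
open KernelSpecInstance (wH wΦ)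
open AffineAveraging (Form1 contourSum curv curvAdj box toSite unitVec)
open AffineReproduction (contourSumAdj)
open ResolventComposition (Hcol HΦcol Hcol_apply HΦcol_apply Hcol_bdd_summable HΦcol_bdd curvAdj_curv_Hcol contourSum_Hcol contourSum_mul
  KInvStep_inr_inl)
open OneStepResolventKernel (Fib KInv KInv_inr_inr_coarse)
open OneStepKernelFamily (KInvStep)
open BalabanStepJetsSucc (E2 lamCoeffK mmRead mmRead_inl_inl mmRead_inr_left)
open BalabanCompositeJets (respStep)
open KKTFluctuationEnergy (lip1 lip2 lip2_comm lip1_curvAdj lip1_contourSumAdj summable_curv summable_mul_of_bdd')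

namespace Summit.QuantumFields.BalabanUV.Beta.GAN24.RespStepEffectiveEL

variable {d : ℕ}

/-- [folklore] Pairing against the INDICATOR 1-form of the bond `(l, w)` evaluates the other form there. -/
theorem lip1_indicator_left (l : Fin (d + 1)) (w : Fin (d + 1) → ℤ) (B : Form1 (d + 1) ℝ) :
    lip1 (fun κ y => if y = w ∧ κ = l then (1 : ℝ) else 0) B = B l w := by
  unfold lip1
  have e : ∀ y : Fin (d + 1) → ℤ, (∑ κ : Fin (d + 1), (if y = w ∧ κ = l then (1 : ℝ) else 0) * B κ y)
      = if y = w then B l w else 0 := by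
    intro y
    by_cases hy : y = w
    · subst hy
      rw [if_pos rfl, Finset.sum_eq_single l (fun κ _ hκ => by rw [if_neg (fun h => hκ h.2), zero_mul])
        (fun h => (h (Finset.mem_univ l)).elim), if_pos ⟨rfl, rfl⟩, one_mul]
    · rw [if_neg hy]
      exact Finset.sum_eq_zero fun κ _ => by rw [if_neg (fun h => hy h.1), zero_mul]
  rw [tsum_congr e, tsum_eq_single w (fun y hy => if_neg hy), if_pos rfl]

/-- [folklore] The indicator 1-form of one bond is summable in each direction (finite support). -/
theorem summable_indicator (l : Fin (d + 1)) (w : Fin (d + 1) → ℤ) (κ : Fin (d + 1)) :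
    Summable (fun y : Fin (d + 1) → ℤ => if y = w ∧ κ = l then (1 : ℝ) else 0) := by
  refine summable_of_ne_finset_zero (s := {w}) fun y hy => ?_
  rw [Finset.mem_singleton] at hy
  exact if_neg fun h => hy h.1

variable {N' M L : ℕ} [NeZero N'] [NeZero M] [NeZero L]

/-- NOT IN PRINT; OUR BOOKKEEPING ([folklore]).  **THE EULER–LAGRANGE IDENTITY OF THE COMPOSITE RESPONSE LEG AT BASE `M` FOR THE LEVEL-`M` EFFECTIVE
HESSIAN KERNEL, TENT FORM**: for `N′ = M·L`, every level-`N′` bond `(μ, z)` and every level-`M` bond `(l, w)`,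
`∑'_{w′} ∑_{l″} HΦcol (N := M) l w l″ w′ · respStep M N′ μ z l″ w′ = contourSumAdj L (HΦcol (N := N′) μ z) l w`.
Left: the level-`M` multiplier kernel `wΦ_M` (= the level-`M` effective Hessian kernel, an2's `E2` ∕ the undressed `colM`) applied to the (K1b′) response leg
`respStep M N′ μ z = 𝒬_M ℋ_{N′}(·; μ, z)`; right: the `L`-CONTOUR-SUM ADJOINT (a tent supported on the `L`-block contours through `(l, w)`) of the level-`N′`
multiplier column.  Proof by pairing `T = ℋ_{N′}(·; μ, z)` and `S = ℋ_M(·; l, w)` through `d*d`, using BOTH Euler–Lagrange identities (`curvAdj_curv_Hcol`),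
`𝒬_{ML} = 𝒬_L𝒬_M` (`contourSum_mul`) and `𝒬_Mℋ_M = δ` (`contourSum_Hcol`). -/
theorem HΦcol_pair_respStep (hN : N' = M * L) (μ : Fin (d + 1)) (z : Fin (d + 1) → ℤ) (l : Fin (d + 1)) (w : Fin (d + 1) → ℤ) :
    ∑' w' : Fin (d + 1) → ℤ, ∑ l'' : Fin (d + 1), HΦcol (N := M) (d := d) l w l'' w' * respStep (d := d) M N' μ z l'' w'
      = contourSumAdj L (HΦcol (N := N') (d := d) μ z) l w := by
  subst hN
  obtain ⟨CT, _, hTb, hTs⟩ := Hcol_bdd_summable (N := M * L) (d := d)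
  obtain ⟨CΦT, _, hΦT⟩ := HΦcol_bdd (N := M * L) (d := d)
  obtain ⟨CS, _, hSb, hSs⟩ := Hcol_bdd_summable (N := M) (d := d)
  obtain ⟨CΦS, _, hΦS⟩ := HΦcol_bdd (N := M) (d := d)
  have hM : 0 < M := Nat.pos_of_ne_zero (NeZero.ne M)
  -- (B) the pairing through `S`'s Euler–Lagrange identity: the LEFT side
  have hB : lip1 (Hcol (N := M * L) μ z) (curvAdj (curv (Hcol (N := M) l w)))
      = ∑' w' : Fin (d + 1) → ℤ, ∑ l'' : Fin (d + 1), HΦcol (N := M) (d := d) l w l'' w' * respStep (d := d) M (M * L) μ z l'' w' := by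
    rw [curvAdj_curv_Hcol, lip1_contourSumAdj (N := M) (hTs μ z) (hΦS l w)]
    rfl
  -- (A) the pairing through `T`'s Euler–Lagrange identity: the RIGHT side
  have hδ : contourSum M (Hcol (N := M) (d := d) l w) = fun κ' y' => if y' = w ∧ κ' = l then (1 : ℝ) else 0 :=
    funext fun κ' => funext fun y' => contourSum_Hcol (N := M) l w κ' y'
  have hA : lip1 (Hcol (N := M * L) μ z) (curvAdj (curv (Hcol (N := M) l w)))
      = contourSumAdj L (HΦcol (N := M * L) (d := d) μ z) l w := by
    rw [lip1_curvAdj (hTb μ z) (fun κ l' => summable_curv (hSs l w) κ l'), lip2_comm,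
      ← lip1_curvAdj (hSb l w) (fun κ l' => summable_curv (hTs μ z) κ l'), curvAdj_curv_Hcol (N := M * L),
      lip1_contourSumAdj (N := M * L) (hSs l w) (hΦT μ z)]
    simp only [contourSum_mul M L hM, hδ]
    rw [← lip1_contourSumAdj (N := L) (summable_indicator l w) (hΦT μ z), lip1_indicator_left]
  exact hB.symm.trans hA

/-- NOT IN PRINT; OUR BOOKKEEPING ([folklore]).  The same identity with the kernels' relative coordinates displayed (`HΦcol_apply`):
`∑'_{w′} ∑_{l″} wΦ_M l″ l (w′ − w) · respStep M N′ μ z l″ w′ = contourSumAdj L (fun κ y ↦ wΦ_{N′} κ μ (y − z)) l w`. -/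
theorem wΦ_pair_respStep (hN : N' = M * L) (μ : Fin (d + 1)) (z : Fin (d + 1) → ℤ) (l : Fin (d + 1)) (w : Fin (d + 1) → ℤ) :
    ∑' w' : Fin (d + 1) → ℤ, ∑ l'' : Fin (d + 1), wΦ (N := M) (d := d) l'' l (w' - w) * respStep (d := d) M N' μ z l'' w'
      = contourSumAdj L (fun κ y => wΦ (N := N') (d := d) κ μ (y - z)) l w := by
  have h := HΦcol_pair_respStep (d := d) hN μ z l w
  simp only [HΦcol_apply] at h
  exact h

/-! ## §2 The step Lagrange coefficient of the comb family is a tent (X-gan24p1-g20-1, «M-Λ») -/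

section StepLagrange

variable {Lc : ℕ} [NeZero Lc]

/-- NOT IN PRINT; OUR BOOKKEEPING ([folklore]; the row owner's located item X-gan24p1-g20-1).  **THE STEP LAGRANGE COEFFICIENT IS A TENT OF THE NEXT-LEVEL
MULTIPLIER COLUMN**: for every `j`, `lamCoeffK (KInvStep Lc j) (E2 d Lc j) Lc μ y κ u = −((Lc^j)^{d+2})⁻¹ · contourSumAdj Lc (fun κ′ y′ ↦ wΦ_{Lc^{j+1}} κ′ μ (y′ − y)) κ u`
— the `(inr μ, inl κ)` entry of `KInvStep Lc j ∘ E2 d Lc j` is the `(Lc^j)^{−(d+2)}`-normalised response leg `respStep (Lc^j) (Lc^{j+1}) μ y` (an5's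
`KInvStep_inr_inl`) paired with the level-`Lc^j` multiplier kernel `wΦ_{Lc^j}` (`E2 = mmRead (KInv)`, `KInv_inr_inr_coarse`), which §1 turns into the tent.
Member `0`'s twin is road S3's `TaylorLamBracket.lamCoeffOf_KInv_eq_neg_contourSumAdj`. -/
theorem lamCoeffK_KInvStep_E2_eq_neg_contourSumAdj (j : ℕ) (μ : Fin (d + 1)) (y : Fin (d + 1) → ℤ) (κ : Fin (d + 1))
    (u : Fin (d + 1) → ℤ) :
    lamCoeffK (KInvStep (d := d) Lc j) (E2 d Lc j) Lc μ y κ u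
      = -((((Lc ^ j : ℕ) : ℝ) ^ (d + 2))⁻¹ * contourSumAdj Lc (fun κ' y' => wΦ (N := Lc ^ (j + 1)) (d := d) κ' μ (y' - y)) κ u) := by
  unfold lamCoeffK ExpKernelCalculus.comp
  have e : ∀ w : Fin (d + 1) → ℤ, (∑ f : Fib d, KInvStep (d := d) Lc j (((Lc : ℕ) : ℤ) • y) w (Sum.inr μ) f * E2 d Lc j w u f (Sum.inl κ))
      = -(((Lc ^ j : ℕ) : ℝ) ^ (d + 2))⁻¹ *
          ∑ α : Fin (d + 1), wΦ (N := Lc ^ j) (d := d) α κ (w - u) * respStep (d := d) (Lc ^ j) (Lc ^ (j + 1)) μ y α w := by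
    intro w
    rw [Fintype.sum_sum_type, Finset.mul_sum]
    simp only [E2, mmRead_inr_left, mul_zero, Finset.sum_const_zero, add_zero, mmRead_inl_inl, KInv_inr_inr_coarse,
      KInvStep_inr_inl]
    refine Finset.sum_congr rfl fun α _ => ?_
    unfold respStep
    ring
  rw [tsum_congr e, tsum_mul_left, ← wΦ_pair_respStep (d := d) (M := Lc ^ j) (L := Lc) (N' := Lc ^ (j + 1)) (pow_succ Lc j) μ y κ u,
    neg_mul]

end StepLagrange

end Summit.QuantumFields.BalabanUV.Beta.GAN24.RespStepEffectiveEL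

end
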